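import Literature.Barriers.ValiantsHypothesis.RankLiftingBarrier
import Literature.Barriers.ValiantsHypothesis.NumericToSymbolicTransfer
import Literature.Barriers.ValiantsHypothesis.NumericToSymbolicProp34
import Mathlib.Algebra.Order.Antidiag.Finsupp
import Mathlib.Logic.Equiv.Basic
import HarnessLib

/-!
# Proof of GMOW 2019, Theorem 1.14 from Corollary 1.23 (§5.2 of the paper)

This file proves the reduction of the barrier theorem `GMOW2019_thm114`
(`RankLiftingBarrier.lean`) to the numeric-to-symbolic transfer `GMOW2019_cor123`
(`NumericToSymbolicTransfer.lean`), following §5 of the paper step by step: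

* the `T_k`-rank method `φ` composed with the parametrisation `ψ(z) = z₁ ⊗ ⋯ ⊗ z_d` of the
  rank-one tensors is a polynomial map `L = φ ∘ ψ` in the `d·n` variables `z = (z_{t,a})`, with
  `trk(L(β)) ≤ r` for every evaluation (§5.2, "Observe that `im(L) = φ(S)`");
* Corollary 1.23 gives `L(z + c) = ∑_{l ≤ r} p_l^{(1)}(z) ⊗ ⋯ ⊗ p_l^{(k)}(z)` (eq. (L-power series));
* comparing the coefficients of the set-multilinear monomials `∏_t z_{t, ι(t)}` (the
  `(1, …, 1)`-component, eq. (L-truncated)) expresses the matrix of `φ` through the coefficient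
  vectors `p^{(j)}_{l, e}` with `smdeg(e)` a zero-one vector, i.e. through set partitions of
  `[d]` into `k` blocks `f : [d] → [k]` (Lemma 5.8: `φ(S)`, hence `φ(V)`, lies in the sum of the
  basic subspaces `C^l_f = ⊗_j span(p^{(j)}_{l,e} : smdeg e = δ_{f⁻¹(j)})`, Lemma 5.2);
* for each `(l, f)` the corresponding piece of `φ(T)` is a sum of `n^{d - |f⁻¹(j⋆)|}` rank-one
  tensors, `j⋆` a largest block (Lemma 5.4: `r(U₁ ⊗ ⋯ ⊗ U_k) ≤ ∏_{j ≠ j⋆} dim U_j`, realised here by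
  an explicit rank-one decomposition indexed by the multi-indices of the other blocks);
* counting (Lemma 5.10): `|f⁻¹(j⋆)| ≥ ⌈d/k⌉`, so each piece has rank `≤ n^{⌊(k-1)d/k⌋}`, and there
  are `k^d` functions `f` and `r` indices `l`: `trk(φ(T)) ≤ k^d · n^{⌊(k-1)d/k⌋} · r`.

Main result: `GMOW2019_thm114_of_cor123 : GMOW2019_cor123 → GMOW2019_thm114`.

## References

* [GargMakamOliveiraWigderson2019] A. Garg, V. Makam, R. Oliveira, A. Wigderson, *More barriers
  for rank methods, via a "numeric to symbolic" transfer*, FOCS 2019 (arXiv:1904.04299), §5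
  (Def. 5.1–5.7, Lemmas 5.2, 5.4, 5.8, 5.10, Cor. 5.9, proof of Thm. 1.14).
-/

noncomputable section

namespace Literature.Barriers.ValiantsHypothesis

open Literature.Computability.AlgebraicComplexity MvPolynomial Finset
open scoped BigOperators

/-! ### Generalities on tensors -/

/-- A rank-one decomposition indexed by a finite type bounds the tensor rank by its cardinality.
[cite: EfremenkoGargOliveiraWigderson2018, §1.2] -/
theorem tensorRankD_le_card_of_eq_sum {F : Type*} [Field F] {m k : ℕ} {I : Type*} [Fintype I]
    (U : I → Fin k → Fin m → F) {S : (Fin k → Fin m) → F}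
    (h : ∑ x, rankOneTensor (U x) = S) : tensorRankD S ≤ Fintype.card I := by
  refine tensorRankD_le_of_eq_sum (fun q => U ((Fintype.equivFin I).symm q)) ?_
  rw [← h]
  exact Fintype.sum_equiv (Fintype.equivFin I).symm _ _ fun _ => rfl

/-- A linear map on tensors in coordinates: `φ(S)_i = ∑_ι S_ι · φ(e_ι)_i`. [folklore] -/
theorem linearMap_apply_eq_sum_mul {F : Type*} [Field F] {n d m k : ℕ}
    (φ : ((Fin d → Fin n) → F) →ₗ[F] ((Fin k → Fin m) → F)) (S : (Fin d → Fin n) → F)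
    (i : Fin k → Fin m) :
    φ S i = ∑ ι, S ι * φ (fun ι' => if ι = ι' then 1 else 0) i := by
  conv_lhs => rw [pi_eq_sum_univ S]
  simp [map_sum, map_smul, Finset.sum_apply, smul_eq_mul]

/-! ### Set-multilinear exponent vectors (§5.1) -/

/-- The exponent vector `∑_{t ∈ S} δ_{(t, ι t)}` evaluated at `(t, a)`. [folklore] -/
theorem sum_single_pair_apply {n d : ℕ} (ι : Fin d → Fin n) (S : Finset (Fin d)) (t : Fin d)
    (a : Fin n) :
    (∑ t' ∈ S, Finsupp.single (t', ι t') (1 : ℕ)) (t, a) = if t ∈ S ∧ ι t = a then 1 else 0 := by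
  classical
  rw [Finsupp.finsetSum_apply]
  simp only [Finsupp.single_apply, Prod.mk.injEq]
  by_cases ht : t ∈ S
  · rw [Finset.sum_eq_single_of_mem t ht]
    · simp [ht]
    · intro t' _ ht'
      simp [ht']
  · rw [Finset.sum_eq_zero]
    · simp [ht]
    · intro t' ht'
      have : t' ≠ t := fun h => ht (h ▸ ht')
      simp [this]

/-- Two such exponent vectors agree with the full multilinear one `∑_t δ_{(t, ι t)}` only for
`S = [d]` and the same multi-index. [folklore] -/
theorem sum_single_pair_eq_iff {n d : ℕ} (ι ι' : Fin d → Fin n) (S : Finset (Fin d)) :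
    ∑ t ∈ S, Finsupp.single (t, ι' t) (1 : ℕ) = ∑ t, Finsupp.single (t, ι t) (1 : ℕ) ↔
      S = univ ∧ ι' = ι := by
  constructor
  · intro h
    have key : ∀ t, t ∈ S ∧ ι' t = ι t := by
      intro t
      have := congrArg (fun e => e (t, ι t)) h
      simp only [sum_single_pair_apply, Finset.mem_univ, true_and, if_true] at this
      by_contra hcon
      rw [if_neg hcon] at this
      exact zero_ne_one this
    exact ⟨Finset.eq_univ_of_forall fun t => (key t).1, funext fun t => (key t).2⟩
  · rintro ⟨rfl, rfl⟩
    rfl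

/-- A sum of natural numbers equals `1` only with exactly one entry `1` and all others `0`.
[folklore] -/
theorem exists_unique_of_sum_eq_one {α : Type*} [Fintype α] (g : α → ℕ) (h : ∑ j, g j = 1) :
    ∃ j, g j = 1 ∧ ∀ j', j' ≠ j → g j' = 0 := by
  classical
  obtain ⟨j, -, hj⟩ := Finset.exists_ne_zero_of_sum_ne_zero (h.symm ▸ one_ne_zero : ∑ j, g j ≠ 0)
  have hle : ∀ j', g j' ≤ 1 := fun j' =>
    h ▸ Finset.single_le_sum (fun _ _ => Nat.zero_le _) (mem_univ j')
  refine ⟨j, by have := hle j; omega, fun j' hj' => ?_⟩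
  have hpair : g j' + g j ≤ 1 := by
    rw [← Finset.sum_pair hj', ← h]
    exact Finset.sum_le_sum_of_subset (subset_univ _)
  omega

/-- **Set partitions index the multilinear part of a `k`-fold product** (§5.1–5.2: the exponent
vectors `e^{(1)}, …, e^{(k)}` with `∑_j smdeg(e^{(j)}) = (1, …, 1)` correspond to the set
partitions `(I₁, …, I_k) ∈ SP(d,k)`, i.e. to functions `f : [d] → [k]`): a sum over the
antidiagonal of the multilinear exponent `∑_t δ_{(t, ι t)}` with `k` parts is a sum over
`f : Fin d → Fin k` of the block exponents `E_f(j) = ∑_{t ∈ f⁻¹(j)} δ_{(t, ι t)}`.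
[cite: GargMakamOliveiraWigderson2019, §5.1 and Lemma 5.8] -/
theorem sum_finsuppAntidiag_multilinear {n d k : ℕ} {M : Type*} [AddCommMonoid M]
    (ι : Fin d → Fin n) (G : (Fin k →₀ (Fin d × Fin n →₀ ℕ)) → M) :
    ∑ E ∈ (univ : Finset (Fin k)).finsuppAntidiag (∑ t, Finsupp.single (t, ι t) (1 : ℕ)), G E =
      ∑ f : Fin d → Fin k, G (Finsupp.equivFunOnFinite.symm
        fun j => ∑ t ∈ univ.filter (fun t => f t = j), Finsupp.single (t, ι t) (1 : ℕ)) := by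
  classical
  set B : (Fin d → Fin k) → (Fin k →₀ (Fin d × Fin n →₀ ℕ)) := fun f =>
    Finsupp.equivFunOnFinite.symm fun j => ∑ t ∈ univ.filter (fun t => f t = j),
      Finsupp.single (t, ι t) (1 : ℕ) with hB
  have hBapply : ∀ f j t a, B f j (t, a) = if f t = j ∧ ι t = a then 1 else 0 := by
    intro f j t a
    simp only [hB, Finsupp.coe_equivFunOnFinite_symm, sum_single_pair_apply, mem_filter,
      mem_univ, true_and]
  -- injectivity
  have hBinj : Function.Injective B := by
    intro f f' hff'
    funext t
    have h1 := congrArg (fun E => E (f t) (t, ι t)) hff'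
    simp only [hBapply, and_self, if_true] at h1
    by_contra hne
    rw [if_neg (fun hc => hne (hc.1.symm))] at h1
    exact one_ne_zero h1
  -- image lands in the antidiagonal
  have hBmem : ∀ f, B f ∈ (univ : Finset (Fin k)).finsuppAntidiag
      (∑ t, Finsupp.single (t, ι t) (1 : ℕ)) := by
    intro f
    rw [mem_finsuppAntidiag]
    refine ⟨?_, subset_univ _⟩
    simp only [hB, Finsupp.coe_equivFunOnFinite_symm]
    exact Finset.sum_fiberwise univ f (fun t => Finsupp.single (t, ι t) (1 : ℕ))
  -- and exhausts it
  have hBsurj : ∀ E ∈ (univ : Finset (Fin k)).finsuppAntidiag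
      (∑ t, Finsupp.single (t, ι t) (1 : ℕ)), ∃ f, B f = E := by
    intro E hE
    rw [mem_finsuppAntidiag] at hE
    obtain ⟨hsum, -⟩ := hE
    have hrow : ∀ t a, ∑ j, E j (t, a) = if ι t = a then 1 else 0 := by
      intro t a
      have := congrArg (fun e => e (t, a)) hsum
      rw [sum_single_pair_apply, Finsupp.finsetSum_apply] at this
      simpa using this
    have hex : ∀ t, ∃ j, E j (t, ι t) = 1 ∧ ∀ j', j' ≠ j → E j' (t, ι t) = 0 := fun t =>
      exists_unique_of_sum_eq_one (fun j => E j (t, ι t)) (by simpa using hrow t (ι t))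
    choose f hf hf' using hex
    refine ⟨f, ?_⟩
    ext j x
    obtain ⟨t, a⟩ := x
    rw [hBapply]
    split_ifs with hc
    · obtain ⟨rfl, rfl⟩ := hc
      exact (hf t).symm
    · by_cases ha : ι t = a
      · subst ha
        have hne : j ≠ f t := fun hj => hc ⟨hj.symm, rfl⟩
        exact (hf' t j hne).symm
      · have h0 : ∑ j, E j (t, a) = 0 := by simpa [ha] using hrow t a
        exact (Finset.sum_eq_zero_iff.1 h0 j (mem_univ _)).symm
  have himage : (univ : Finset (Fin k)).finsuppAntidiag (∑ t, Finsupp.single (t, ι t) (1 : ℕ)) =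
      univ.image B := by
    ext E
    constructor
    · intro hE
      obtain ⟨f, rfl⟩ := hBsurj E hE
      exact mem_image_of_mem B (mem_univ f)
    · intro hE
      obtain ⟨f, -, rfl⟩ := mem_image.1 hE
      exact hBmem f
  rw [himage, Finset.sum_image fun f _ f' _ hff' => hBinj hff']

/-- **The multilinear coefficient of a `k`-fold product of power series** (eq. (L-truncated)):
`coeff_{∏_t z_{t,ι(t)}} (q₁ ⋯ q_k) = ∑_{f : [d] → [k]} ∏_j coeff_{E_f(j)} (q_j)`.
[cite: GargMakamOliveiraWigderson2019, §5.2 (eq. L-truncated)] -/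
theorem coeff_prod_multilinear {F : Type*} [Field F] {n d k : ℕ} (ι : Fin d → Fin n)
    (q : Fin k → MvPowerSeries (Fin d × Fin n) F) :
    MvPowerSeries.coeff (∑ t, Finsupp.single (t, ι t) (1 : ℕ)) (∏ j, q j) =
      ∑ f : Fin d → Fin k, ∏ j, MvPowerSeries.coeff
        (∑ t ∈ univ.filter (fun t => f t = j), Finsupp.single (t, ι t) (1 : ℕ)) (q j) := by
  classical
  rw [MvPowerSeries.coeff_prod, sum_finsuppAntidiag_multilinear ι]
  simp only [Finsupp.coe_equivFunOnFinite_symm]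

/-- **The multilinear coefficients of `L(z + c)` are the matrix of `φ`**: for
`L_i(z) = ∑_{ι'} Φ(ι') ∏_t z_{t, ι'(t)}` (set-multilinear of set-multidegree `(1, …, 1)`), the
coefficient of `∏_t z_{t, ι(t)}` in `L_i(z + c)` is `Φ(ι)` ("`L(z) = L(z + c)_{(1,…,1)}`", §5.2).
[cite: GargMakamOliveiraWigderson2019, §5.2] -/
theorem coeff_multilinear_aeval_shift {F : Type*} [Field F] {n d : ℕ} (Φ : (Fin d → Fin n) → F)
    (c : Fin d × Fin n → F) (ι : Fin d → Fin n) :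
    MvPolynomial.coeff (∑ t, Finsupp.single (t, ι t) (1 : ℕ))
      (aeval (fun v => (X v + C (c v) : MvPolynomial (Fin d × Fin n) F))
        (∑ ι', C (Φ ι') * ∏ t, X (t, ι' t))) = Φ ι := by
  classical
  have hX : ∀ (ι' : Fin d → Fin n) (S : Finset (Fin d)),
      ∏ t ∈ S, (X (t, ι' t) : MvPolynomial (Fin d × Fin n) F) =
        monomial (∑ t ∈ S, Finsupp.single (t, ι' t) 1) 1 := by
    intro ι' S
    rw [monomial_sum_one]
    rfl
  have hmc : ∀ (e : Fin d × Fin n →₀ ℕ) (b : F),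
      (monomial e (1 : F)) * C b = monomial e b := fun e b => by
    rw [mul_comm, C_mul_monomial, mul_one]
  simp only [map_sum, map_mul, aeval_C, algebraMap_eq, map_prod, aeval_X]
  simp_rw [Finset.prod_add, hX, ← map_prod C, hmc, Finset.mul_sum, coeff_sum, coeff_C_mul,
    coeff_monomial, sum_single_pair_eq_iff]
  rw [Finset.sum_eq_single ι]
  · rw [Finset.sum_eq_single (univ : Finset (Fin d))]
    · simp
    · intro S _ hS
      simp [hS]
    · intro h
      exact absurd (mem_powerset_self _) h
  · intro ι' _ hι'
    simp [hι']
  · intro h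
    exact absurd (mem_univ ι) h

/-- **One block is free** (Lemma 5.4, `r(U₁ ⊗ ⋯ ⊗ U_k) ≤ ∏_{j ≠ j⋆} dim U_j`, in coordinates): for
a fixed set partition `f : [d] → [k]` and a block `j⋆`, the contraction of `T` against the block
coefficient tensors `⊗_j P_j(E_f(j))` is a sum of rank-one tensors indexed by the multi-indices
of the blocks other than `j⋆` — the `j⋆`-th factor absorbs the sum over the indices in `f⁻¹(j⋆)`.
[cite: GargMakamOliveiraWigderson2019, Lemma 5.4] -/
theorem exists_rankOne_regroup {F : Type*} [Field F] {n d m k : ℕ} (T : (Fin d → Fin n) → F)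
    (P : Fin k → Fin m → (Fin d × Fin n →₀ ℕ) → F) (f : Fin d → Fin k) (js : Fin k)
    (ι₀ : Fin d → Fin n) :
    ∃ u : ({t // f t ≠ js} → Fin n) → Fin k → Fin m → F, ∀ i : Fin k → Fin m,
      ∑ ι : Fin d → Fin n, T ι * ∏ j, P j (i j)
          (∑ t ∈ univ.filter (fun t => f t = j), Finsupp.single (t, ι t) (1 : ℕ)) =
        ∑ ι₁, rankOneTensor (u ι₁) i := by
  classical
  set e := Equiv.piEquivPiSubtypeProd (fun t => f t ≠ js) (fun _ => Fin n) with he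
  set B : (Fin d → Fin n) → Fin k → (Fin d × Fin n →₀ ℕ) := fun ι j =>
    ∑ t ∈ univ.filter (fun t => f t = j), Finsupp.single (t, ι t) (1 : ℕ) with hB
  have hind : ∀ ι₁ ι₂ ι₂' j, j ≠ js → B (e.symm (ι₁, ι₂)) j = B (e.symm (ι₁, ι₂')) j := by
    intro ι₁ ι₂ ι₂' j hj
    refine Finset.sum_congr rfl fun t ht => ?_
    have hft : f t ≠ js := by rw [(mem_filter.1 ht).2]; exact hj
    simp [he, hft]
  refine ⟨fun ι₁ j x => if j = js then
      ∑ ι₂, T (e.symm (ι₁, ι₂)) * P js x (B (e.symm (ι₁, ι₂)) js)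
      else P j x (B (e.symm (ι₁, (e ι₀).2)) j), fun i => ?_⟩
  rw [Fintype.sum_equiv e _ (fun q => T (e.symm q) * ∏ j, P j (i j) (B (e.symm q) j))
    (fun ι => by rw [Equiv.symm_apply_apply]), Fintype.sum_prod_type]
  refine Finset.sum_congr rfl fun ι₁ _ => ?_
  have hsplit : ∀ ι₂, ∏ j, P j (i j) (B (e.symm (ι₁, ι₂)) j) =
      P js (i js) (B (e.symm (ι₁, ι₂)) js) *
        ∏ j ∈ univ.erase js, P j (i j) (B (e.symm (ι₁, (e ι₀).2)) j) := by
    intro ι₂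
    rw [← Finset.mul_prod_erase univ _ (mem_univ js)]
    congr 1
    exact prod_congr rfl fun j hj => by rw [hind ι₁ ι₂ (e ι₀).2 j (ne_of_mem_erase hj)]
  simp_rw [hsplit]
  rw [rankOneTensor_apply, ← Finset.mul_prod_erase univ _ (mem_univ js)]
  rw [if_pos rfl, prod_congr rfl (fun j hj => if_neg (ne_of_mem_erase hj)), Finset.sum_mul]
  refine Finset.sum_congr rfl fun ι₂ _ => ?_
  ring

/-! ### Arithmetic of the exponent (Lemma 5.10) -/

/-- `d - M ≤ ⌊(k-1)d/k⌋` when `k · M ≥ d` (the largest of `k` blocks partitioning `[d]` has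
`M ≥ ⌈d/k⌉` elements). [cite: GargMakamOliveiraWigderson2019, Lemma 5.10] -/
theorem sub_le_pred_mul_div {d k M : ℕ} (hk : 0 < k) (hM : M ≤ d) (h : d ≤ k * M) :
    d - M ≤ (k - 1) * d / k := by
  rw [Nat.le_div_iff_mul_le hk]
  have h1 : (d - M) * k + M * k = d * k := by rw [← Nat.add_mul, Nat.sub_add_cancel hM]
  have h2 : (k - 1) * d + d = d * k := by
    rw [Nat.sub_one_mul, Nat.mul_comm k d, Nat.sub_add_cancel (Nat.le_mul_of_pos_right d hk)]
  have h3 : d ≤ M * k := by rwa [Nat.mul_comm] at h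
  generalize (d - M) * k = A at h1
  generalize (k - 1) * d = B at h2
  generalize M * k = P at h1 h3
  generalize d * k = Q at h1 h2
  omega

/-- Pigeonhole: some fibre of `f : [d] → [k]` has at least `d/k` elements.
[cite: GargMakamOliveiraWigderson2019, Lemma 5.10] -/
theorem exists_fiber_card_ge {d k : ℕ} (hk : 0 < k) (f : Fin d → Fin k) :
    ∃ j : Fin k, d ≤ k * #{t | f t = j} := by
  classical
  obtain ⟨j, -, hj⟩ := Finset.exists_max_image (univ : Finset (Fin k))
    (fun j => #{t | f t = j}) ⟨⟨0, hk⟩, mem_univ _⟩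
  refine ⟨j, ?_⟩
  have hsum : #(univ : Finset (Fin d)) = ∑ j' : Fin k, #{t | f t = j'} :=
    card_eq_sum_card_fiberwise fun t _ => by simp
  calc d = ∑ j' : Fin k, #{t | f t = j'} := by rw [← hsum, card_univ, Fintype.card_fin]
    _ ≤ ∑ _j' : Fin k, #{t | f t = j} := sum_le_sum fun j' _ => hj j' (mem_univ _)
    _ = k * #{t | f t = j} := by simp

/-! ### Theorem 1.14 from Corollary 1.23 -/

/-- **Garg–Makam–Oliveira–Wigderson 2019, Theorem 1.14, from Corollary 1.23** (the whole of
§5.2): for a `T_k`-rank method `φ : Ten(n,d) → Ten(m,k)` with `trk(φ(s)) ≤ r` on rank-one tensors,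
`trk(φ(T)) ≤ k^d · n^{⌊(k-1)d/k⌋} · r` for every `T`, over an algebraically closed field of
characteristic zero. [cite: GargMakamOliveiraWigderson2019, Thm. 1.14 (proof, §5.2)] -/
theorem GMOW2019_thm114_of_cor123 (h : GMOW2019_cor123) : GMOW2019_thm114 := by
  intro F _ _ _ n d m k hk φ r hr T
  classical
  -- the degenerate case `n = 0 < d`: no multi-indices, `T = 0`
  rcases isEmpty_or_nonempty (Fin d → Fin n) with hE | hne
  · have hT : T = 0 := Subsingleton.elim _ _
    subst hT
    rw [map_zero]
    exact (sComplexity_zero _).le.trans (Nat.zero_le _)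
  obtain ⟨ι₀⟩ := hne
  -- Step 1: the matrix of `φ` and the polynomial map `L = φ ∘ ψ` in the variables `z_{t,a}`
  set Φ : (Fin k → Fin m) → (Fin d → Fin n) → F :=
    fun i ι => φ (fun ι' => if ι = ι' then 1 else 0) i with hΦ
  have hφ : ∀ (S : (Fin d → Fin n) → F) (i : Fin k → Fin m), φ S i = ∑ ι, S ι * Φ i ι :=
    fun S i => linearMap_apply_eq_sum_mul φ S i
  set L : (Fin k → Fin m) → MvPolynomial (Fin d × Fin n) F :=
    fun i => ∑ ι, C (Φ i ι) * ∏ t, X (t, ι t) with hL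
  have hLeval : ∀ β : Fin d × Fin n → F,
      (fun i => eval β (L i)) = φ (rankOneTensor fun t a => β (t, a)) := by
    intro β
    funext i
    rw [hφ]
    simp only [hL, map_sum, map_mul, eval_C, map_prod, eval_X, rankOneTensor_apply]
    exact Finset.sum_congr rfl fun ι _ => mul_comm _ _
  have hLr : ∀ β : Fin d × Fin n → F, tensorRankD (fun i => eval β (L i)) ≤ r := fun β => by
    rw [hLeval β]
    exact hr _
  -- Step 2: the power series decomposition of `L(z + c)` (Corollary 1.23)
  obtain ⟨c, p, hp⟩ := h F (Fin d × Fin n) m k r (by omega) L hLr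
  -- Step 3: compare the multilinear coefficients (eq. (L-truncated))
  have hstar : ∀ (i : Fin k → Fin m) (ι : Fin d → Fin n), Φ i ι =
      ∑ l, ∑ f : Fin d → Fin k, ∏ j, MvPowerSeries.coeff
        (∑ t ∈ univ.filter (fun t => f t = j), Finsupp.single (t, ι t) (1 : ℕ)) (p l j (i j)) := by
    intro i ι
    have h1 := congrArg (MvPowerSeries.coeff (∑ t, Finsupp.single (t, ι t) (1 : ℕ))) (hp i)
    rw [MvPolynomial.coeff_coe, coeff_multilinear_aeval_shift, map_sum] at h1
    rw [h1]
    exact Finset.sum_congr rfl fun l _ => coeff_prod_multilinear ι fun j => p l j (i j)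
  -- Step 4: a largest block for every set partition `f : [d] → [k]`
  have hjex : ∀ f : Fin d → Fin k, ∃ j : Fin k, d ≤ k * #{t | f t = j} :=
    fun f => exists_fiber_card_ge (by omega) f
  choose jstar hjstar using hjex
  -- Step 5: each `(l, f)`-piece of `φ(T)` is a sum of rank-one tensors over the other blocks
  have hreg : ∀ (l : Fin r) (f : Fin d → Fin k),
      ∃ u : ({t // f t ≠ jstar f} → Fin n) → Fin k → Fin m → F, ∀ i : Fin k → Fin m,
        ∑ ι : Fin d → Fin n, T ι * ∏ j, MvPowerSeries.coeff
            (∑ t ∈ univ.filter (fun t => f t = j), Finsupp.single (t, ι t) (1 : ℕ)) (p l j (i j)) =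
          ∑ ι₁, rankOneTensor (u ι₁) i :=
    fun l f => exists_rankOne_regroup T (fun j x e => MvPowerSeries.coeff e (p l j x)) f
      (jstar f) ι₀
  choose u hu using hreg
  have hdec : ∑ x : (Σ l : Fin r, Σ f : Fin d → Fin k, ({t // f t ≠ jstar f} → Fin n)),
      rankOneTensor (u x.1 x.2.1 x.2.2) = φ T := by
    funext i
    rw [Finset.sum_apply, hφ T i, Fintype.sum_sigma]
    simp_rw [Fintype.sum_sigma, hstar i, Finset.mul_sum]
    conv_rhs => rw [Finset.sum_comm]
    refine Finset.sum_congr rfl fun l _ => ?_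
    conv_rhs => rw [Finset.sum_comm]
    refine Finset.sum_congr rfl fun f _ => ?_
    exact (hu l f i).symm
  -- Step 6: count (Lemma 5.10)
  have hpow : ∀ f : Fin d → Fin k,
      Fintype.card ({t // f t ≠ jstar f} → Fin n) ≤ n ^ ((k - 1) * d / k) := by
    intro f
    rw [Fintype.card_fun, Fintype.card_fin, Fintype.card_subtype_compl, Fintype.card_fin,
      Fintype.card_subtype]
    rcases Nat.eq_zero_or_pos d with rfl | hd
    · simp
    · have hn : 0 < n := by
        rcases Nat.eq_zero_or_pos n with rfl | hn
        · exact absurd (ι₀ ⟨0, hd⟩).2 (by omega)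
        · exact hn
      exact Nat.pow_le_pow_right hn
        (sub_le_pred_mul_div (by omega) (card_filter_le _ _ |>.trans (by simp)) (hjstar f))
  calc tensorRankD (φ T)
      ≤ Fintype.card (Σ l : Fin r, Σ f : Fin d → Fin k, ({t // f t ≠ jstar f} → Fin n)) :=
        tensorRankD_le_card_of_eq_sum _ hdec
    _ = ∑ _l : Fin r, ∑ f : Fin d → Fin k, Fintype.card ({t // f t ≠ jstar f} → Fin n) := by
        simp only [Fintype.card_sigma]
    _ ≤ ∑ _l : Fin r, ∑ _f : Fin d → Fin k, n ^ ((k - 1) * d / k) :=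
        sum_le_sum fun l _ => sum_le_sum fun f _ => hpow f
    _ = k ^ d * n ^ ((k - 1) * d / k) * r := by
        simp only [sum_const, card_univ, Fintype.card_fun, Fintype.card_fin, smul_eq_mul]
        ring

/-! ### Theorem 1.14, discharged -/

/-- **Garg–Makam–Oliveira–Wigderson 2019, Theorem 1.14** (discharge of the named fact
`GMOW2019_thm114` of `RankLiftingBarrier.lean`): over an algebraically closed field of
characteristic zero, every `T_k`-rank method `φ : Ten(n,d) → Ten(m,k)` (`k ≥ 2`) has potency
`≤ k^d · n^{⌊(k-1)d/k⌋}` — unconditionally, by `GMOW2019_thm114_of_cor123` (§5.2) and the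
discharged numeric-to-symbolic transfer `GMOW2019_cor123_holds` (Cor. 1.23 ⇐ Thm. 1.21 ⇐
Props. 3.3, 3.4). [cite: GargMakamOliveiraWigderson2019, Thm. 1.14] -/
theorem GMOW2019_thm114_holds : GMOW2019_thm114 :=
  GMOW2019_thm114_of_cor123 GMOW2019_cor123_holds

end Literature.Barriers.ValiantsHypothesis
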